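import Literature.MathematicalPhysics.QuantumLattice.DysonOrderedIntegral
import Mathlib.Algebra.BigOperators.NatAntidiagonal
import HarnessLib

/-!
# The shuffle (exponential convolution) formula for ordered simplex integrals

Topic `MathematicalPhysics/QuantumLattice`; companion of `DysonOrderedIntegral.lean`
(`orderedIntegral k F t = ∫_{0 ≤ u₀ ≤ ⋯ ≤ u_{k-1} ≤ t} F(u) du`, the shape of the `k`-th Dyson
term). Programme under the tree's fact `bgm_two_point_limit` (`HubbardFermiLiquid.lean`): the
passage from the perturbation series of `Tr(e^{-βH} c†c)` and `Tr e^{-βH}` (ordered time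
integrals, `HubbardDysonDeterminant.lean`) to the linked-cluster / truncated-expectation series of
their RATIO (Benfatto–Giuliani–Mastropietro 2006, (2.13)–(2.16); Mastropietro 2008, §2.3) rests on
the elementary **shuffle product** of ordered integrals: splitting the integration variables
`u₀ ≤ ⋯ ≤ u_{n-1}` into the sub-tuple on an index set `S` and the sub-tuple on `Sᶜ` and summing
over `S` reproduces all relative orderings, so that

`∫_{Δₙ(t)} Σ_{S ⊆ n} F_{|S|}(u|_S) G_{|Sᶜ|}(u|_{Sᶜ}) du = Σ_{j+m=n} (∫_{Δ_j(t)} F_j)(∫_{Δ_m(t)} G_m)`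

(`orderedIntegral_sum_tupleOn_mul`) for families `F = (F_j)_j`, `G = (G_m)_m` of continuous
integrands — the identity behind `(Σ aⱼ zʲ)(Σ b_m z^m)` for exponential generating functions
written with simplex volumes instead of factorials (Brydges 1986, §2).
Proof: both sides vanish at `t = 0` and have the same derivative in `t` (fundamental theorem of
calculus for the outermost variable, `hasDerivAt_orderedIntegral_succ`, and the product rule),
by induction on `n`.

Also: `tupleOn S h u` (the sub-tuple of `u` on `S`, increasing enumeration) and its behaviour
under appending a last coordinate (`tupleOn_map_castSuccEmb_snoc`, `tupleOn_insert_last_snoc`),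
the splitting of sums over subsets of `Fin (n+1)` (`sum_finset_fin_succ`), additivity of
`orderedIntegral`, `orderedIntegral_succ_zero`, and the derivative family `orderedIntegralDeriv`
(`hasDerivAt_orderedIntegral_family`). Everything is PROVED; the only definitions are `tupleOn`
and `orderedIntegralDeriv`.

## References

* D. C. Brydges, *A short course on cluster expansions*, Les Houches 1984 (North-Holland 1986),
  §2 (tree/forest formulas: ordered "time" integrals and their combinatorics). [Brydges1986]
* G. Benfatto, A. Giuliani, V. Mastropietro, Ann. Henri Poincaré 7 (2006) 809–898, §2.1–2.2
  (2.6)–(2.8), (2.13)–(2.16). [BenfattoGiulianiMastropietro2006]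
* O. Bratteli, D. W. Robinson, *Operator Algebras and Quantum Statistical Mechanics II*, 2nd ed.
  (Springer 1997), §5.4.1 (Dyson/time-ordered perturbation expansions). [BratteliRobinsonII1997]
-/

noncomputable section

open Finset MeasureTheory intervalIntegral

namespace Literature.MathematicalPhysics.QuantumLattice

/-! ### Sub-tuples on an index set -/

section TupleOn

variable {X : Type*}

/-- The **sub-tuple** of `u : Fin n → X` on the index set `S ⊆ Fin n` of cardinality `k`, listed in
increasing order of the indices (`S.orderEmbOfFin h`). [folklore] -/
def tupleOn {n : ℕ} (S : Finset (Fin n)) {k : ℕ} (h : S.card = k) (u : Fin n → X) : Fin k → X :=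
  fun i => u (S.orderEmbOfFin h i)

/-- Unfolding `tupleOn`. [folklore] -/
@[simp] theorem tupleOn_apply {n : ℕ} (S : Finset (Fin n)) {k : ℕ} (h : S.card = k) (u : Fin n → X)
    (i : Fin k) : tupleOn S h u i = u (S.orderEmbOfFin h i) := rfl

/-- `tupleOn` commutes with post-composition. [folklore] -/
theorem comp_tupleOn {Y : Type*} {n : ℕ} (S : Finset (Fin n)) {k : ℕ} (h : S.card = k)
    (u : Fin n → X) (g : X → Y) : g ∘ tupleOn S h u = tupleOn S h (g ∘ u) := rfl

variable {n : ℕ}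

/-- `Fin.last n` is not in the image of `Fin n` under `castSucc`. [folklore] -/
theorem last_notMem_map_castSuccEmb (T : Finset (Fin n)) : Fin.last n ∉ T.map Fin.castSuccEmb := by
  simp only [mem_map, Fin.castSuccEmb_apply, not_exists, not_and]
  exact fun x _ => (Fin.castSucc_lt_last x).ne

/-- `castSucc j ∈ T.map castSucc ↔ j ∈ T`. [folklore] -/
theorem castSucc_mem_map_castSuccEmb (T : Finset (Fin n)) (j : Fin n) :
    Fin.castSucc j ∈ T.map Fin.castSuccEmb ↔ j ∈ T := by
  rw [← Fin.castSuccEmb_apply, mem_map' Fin.castSuccEmb]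

/-- Cardinality of `insert (last n) (T.map castSucc)`. [folklore] -/
theorem card_insert_last_map_castSuccEmb (T : Finset (Fin n)) :
    (insert (Fin.last n) (T.map Fin.castSuccEmb)).card = T.card + 1 := by
  rw [card_insert_of_notMem (last_notMem_map_castSuccEmb T), card_map]

/-- The increasing enumeration of `T.map castSucc` is `castSucc ∘` (that of `T`). [folklore] -/
theorem orderEmbOfFin_map_castSuccEmb (T : Finset (Fin n)) {k : ℕ}
    (h : (T.map Fin.castSuccEmb).card = k) (h' : T.card = k) (i : Fin k) :
    (T.map Fin.castSuccEmb).orderEmbOfFin h i = Fin.castSucc (T.orderEmbOfFin h' i) := by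
  have hu := orderEmbOfFin_unique h (f := fun i => Fin.castSucc (T.orderEmbOfFin h' i))
    (fun i => (castSucc_mem_map_castSuccEmb T _).2 (orderEmbOfFin_mem T h' i))
    (fun a b hab => Fin.castSucc_lt_castSucc_iff.2 ((T.orderEmbOfFin h').strictMono hab))
  exact (congrFun hu i).symm

/-- **Sub-tuples not containing the last index ignore the appended coordinate**:
`(w, x)|_{T} = w|_T` for `T ⊆ Fin n ↪ Fin (n+1)`. [folklore] -/
theorem tupleOn_map_castSuccEmb_snoc (T : Finset (Fin n)) {k : ℕ}
    (h : (T.map Fin.castSuccEmb).card = k) (h' : T.card = k) (w : Fin n → X) (x : X) :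
    tupleOn (T.map Fin.castSuccEmb) h (Fin.snoc w x : Fin (n + 1) → X) = tupleOn T h' w := by
  funext i
  simp only [tupleOn_apply, orderEmbOfFin_map_castSuccEmb T h h', Fin.snoc_castSucc]

/-- `Fin.snoc` of a strictly monotone `castSucc`-valued tuple with `last` is strictly monotone.
[folklore] -/
theorem strictMono_snoc_castSucc_last {k : ℕ} {e : Fin k → Fin n} (he : StrictMono e) :
    StrictMono (Fin.snoc (fun i => Fin.castSucc (e i)) (Fin.last n) : Fin (k + 1) → Fin (n + 1)) := by
  intro a b hab
  induction b using Fin.lastCases with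
  | last =>
    induction a using Fin.lastCases with
    | last => exact absurd hab (lt_irrefl _)
    | cast a =>
      simp only [Fin.snoc_castSucc, Fin.snoc_last]
      exact Fin.castSucc_lt_last _
  | cast b =>
    induction a using Fin.lastCases with
    | last => exact absurd hab (not_lt.mpr (Fin.le_last _))
    | cast a =>
      simp only [Fin.snoc_castSucc]
      exact Fin.castSucc_lt_castSucc_iff.2 (he (Fin.castSucc_lt_castSucc_iff.1 hab))

/-- The increasing enumeration of `insert (last n) (T.map castSucc)` is that of `T` (through
`castSucc`) followed by `last n`. [folklore] -/
theorem orderEmbOfFin_insert_last (T : Finset (Fin n)) {k : ℕ}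
    (h : (insert (Fin.last n) (T.map Fin.castSuccEmb)).card = k + 1) (h' : T.card = k) :
    ⇑((insert (Fin.last n) (T.map Fin.castSuccEmb)).orderEmbOfFin h) =
      (Fin.snoc (fun i => Fin.castSucc (T.orderEmbOfFin h' i)) (Fin.last n) :
        Fin (k + 1) → Fin (n + 1)) := by
  symm
  refine orderEmbOfFin_unique h (fun i => ?_)
    (strictMono_snoc_castSucc_last (T.orderEmbOfFin h').strictMono)
  induction i using Fin.lastCases with
  | last => simp only [Fin.snoc_last, mem_insert_self]
  | cast j =>
    simp only [Fin.snoc_castSucc]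
    exact mem_insert_of_mem ((castSucc_mem_map_castSuccEmb T _).2 (orderEmbOfFin_mem T h' j))

/-- **Sub-tuples containing the last index end with the appended coordinate**:
`(w, x)|_{T ∪ {last}} = (w|_T, x)`. [folklore] -/
theorem tupleOn_insert_last_snoc (T : Finset (Fin n)) {k : ℕ}
    (h : (insert (Fin.last n) (T.map Fin.castSuccEmb)).card = k + 1) (h' : T.card = k)
    (w : Fin n → X) (x : X) :
    tupleOn (insert (Fin.last n) (T.map Fin.castSuccEmb)) h (Fin.snoc w x : Fin (n + 1) → X) =
      Fin.snoc (tupleOn T h' w) x := by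
  funext i
  rw [tupleOn_apply, orderEmbOfFin_insert_last T h h']
  induction i using Fin.lastCases with
  | last => simp only [Fin.snoc_last]
  | cast j => simp only [Fin.snoc_castSucc, tupleOn_apply]

/-- Complement of `T.map castSucc` in `Fin (n+1)`. [folklore] -/
theorem compl_map_castSuccEmb (T : Finset (Fin n)) :
    (T.map Fin.castSuccEmb)ᶜ = insert (Fin.last n) (Tᶜ.map Fin.castSuccEmb) := by
  ext i
  induction i using Fin.lastCases with
  | last =>
    simp only [mem_compl, last_notMem_map_castSuccEmb, not_false_eq_true, mem_insert_self]
  | cast j =>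
    rw [mem_compl, castSucc_mem_map_castSuccEmb, mem_insert, castSucc_mem_map_castSuccEmb, mem_compl]
    simp only [(Fin.castSucc_lt_last j).ne, false_or]

/-- Complement of `insert (last n) (T.map castSucc)` in `Fin (n+1)`. [folklore] -/
theorem compl_insert_last_map_castSuccEmb (T : Finset (Fin n)) :
    (insert (Fin.last n) (T.map Fin.castSuccEmb))ᶜ = Tᶜ.map Fin.castSuccEmb := by
  rw [← compl_compl (Tᶜ.map Fin.castSuccEmb), compl_map_castSuccEmb, compl_compl]

/-- **Subsets of `Fin (n+1)` are the subsets of `Fin n` with or without the last element**: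
`Σ_{S ⊆ Fin (n+1)} Φ(S) = Σ_{T ⊆ Fin n} (Φ(T) + Φ(T ∪ {last}))`. [folklore] -/
theorem sum_finset_fin_succ {M : Type*} [AddCommMonoid M] (Φ : Finset (Fin (n + 1)) → M) :
    ∑ S, Φ S = ∑ T : Finset (Fin n),
      (Φ (T.map Fin.castSuccEmb) + Φ (insert (Fin.last n) (T.map Fin.castSuccEmb))) := by
  classical
  have hs : (univ : Finset (Finset (Fin (n + 1)))) =
      (insert (Fin.last n) ((univ : Finset (Fin n)).image Fin.castSucc)).powerset := by
    rw [← powerset_univ, Fin.univ_castSuccEmb, cons_eq_insert, map_eq_image]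
    rfl
  have hnot : Fin.last n ∉ (univ : Finset (Fin n)).image Fin.castSucc := by
    simp only [mem_image, mem_univ, true_and, not_exists]
    exact fun x => (Fin.castSucc_lt_last x).ne
  have hdisj : Disjoint ((univ : Finset (Fin n)).image Fin.castSucc).powerset
      ((((univ : Finset (Fin n)).image Fin.castSucc).powerset).image (insert (Fin.last n))) := by
    rw [disjoint_left]
    intro S hS hS'
    obtain ⟨S₀, _, rfl⟩ := mem_image.1 hS'
    exact notMem_of_mem_powerset_of_notMem hS hnot (mem_insert_self _ _)
  have hinj : Set.InjOn (insert (Fin.last n))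
      ((((univ : Finset (Fin n)).image Fin.castSucc).powerset : Finset (Finset (Fin (n + 1)))) :
        Set (Finset (Fin (n + 1)))) := by
    intro S hS S' hS' hSS'
    rw [← erase_insert (notMem_of_mem_powerset_of_notMem (mem_coe.1 hS) hnot), hSS',
      erase_insert (notMem_of_mem_powerset_of_notMem (mem_coe.1 hS') hnot)]
  have himg : ∀ Ψ : Finset (Fin (n + 1)) → M,
      ∑ S ∈ ((univ : Finset (Fin n)).image Fin.castSucc).powerset, Ψ S =
        ∑ T : Finset (Fin n), Ψ (T.map Fin.castSuccEmb) := by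
    intro Ψ
    rw [powerset_image, sum_image, powerset_univ]
    · refine sum_congr rfl fun T _ => ?_
      rw [map_eq_image]; rfl
    · intro T _ T' _ hTT'
      exact (image_injective (Fin.castSucc_injective n)) hTT'
  rw [sum_add_distrib, hs, powerset_insert, sum_union hdisj, sum_image hinj, himg, himg]

end TupleOn

/-! ### Calculus of ordered integrals -/

section Calculus

variable {E : Type*} [NormedAddCommGroup E] [NormedSpace ℝ E]

/-- An ordered integral with at least one variable vanishes at `t = 0`. [folklore] -/
@[simp] theorem orderedIntegral_succ_zero (k : ℕ) (F : (Fin (k + 1) → ℝ) → E) :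
    orderedIntegral (k + 1) F 0 = 0 := by
  rw [orderedIntegral_succ, integral_same]

/-- The inner integrand of `I_{k+1} F` is continuous in the outer variable. [folklore] -/
theorem continuous_orderedIntegral_snoc (k : ℕ) {F : (Fin (k + 1) → ℝ) → E} (hF : Continuous F) :
    Continuous fun s : ℝ => orderedIntegral k (fun w => F (Fin.snoc w s)) s :=
  continuous_orderedIntegral k (fun (s : ℝ) w => F (Fin.snoc w s))
    (hF.comp ((continuous_finSnoc k).comp (continuous_snd.prodMk continuous_fst))) id continuous_id

/-- **Additivity of ordered integrals** in the integrand (continuous integrands). [folklore] -/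
theorem orderedIntegral_add :
    ∀ (k : ℕ) {F G : (Fin k → ℝ) → E}, Continuous F → Continuous G → ∀ t : ℝ,
      orderedIntegral k (fun u => F u + G u) t = orderedIntegral k F t + orderedIntegral k G t
  | 0, _, _, _, _, _ => rfl
  | k + 1, F, G, hF, hG, t => by
    rw [orderedIntegral_succ, orderedIntegral_succ, orderedIntegral_succ,
      ← integral_add ((continuous_orderedIntegral_snoc k hF).intervalIntegrable 0 t)
        ((continuous_orderedIntegral_snoc k hG).intervalIntegrable 0 t)]
    refine integral_congr fun s _ => ?_
    exact orderedIntegral_add k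
      (hF.comp ((continuous_finSnoc k).comp (continuous_id.prodMk continuous_const)))
      (hG.comp ((continuous_finSnoc k).comp (continuous_id.prodMk continuous_const))) s

/-- The ordered integral of the zero integrand vanishes. [folklore] -/
theorem orderedIntegral_zero_fun : ∀ (k : ℕ) (t : ℝ), orderedIntegral k (fun _ => (0 : E)) t = 0
  | 0, _ => rfl
  | k + 1, t => by
    rw [orderedIntegral_succ]
    simp only [orderedIntegral_zero_fun k, intervalIntegral.integral_zero]

/-- **Finite additivity of ordered integrals** (continuous integrands). [folklore] -/
theorem orderedIntegral_finset_sum {ι : Type*} (s : Finset ι) (k : ℕ) {F : ι → (Fin k → ℝ) → E}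
    (hF : ∀ i ∈ s, Continuous (F i)) (t : ℝ) :
    orderedIntegral k (fun u => ∑ i ∈ s, F i u) t = ∑ i ∈ s, orderedIntegral k (F i) t := by
  classical
  induction s using Finset.induction_on with
  | empty => simpa only [sum_empty] using orderedIntegral_zero_fun k t
  | insert a s ha ih =>
    have hFa : Continuous (F a) := hF a (mem_insert_self a s)
    have hFs : ∀ i ∈ s, Continuous (F i) := fun i hi => hF i (mem_insert_of_mem hi)
    simp only [sum_insert ha]
    rw [← ih hFs, ← orderedIntegral_add k hFa (continuous_finsetSum s fun i hi => hFs i hi) t]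

variable [CompleteSpace E]

/-- **Fundamental theorem of calculus for ordered integrals**:
`d/dt I_{k+1} F t = I_k (F(·, t)) t` for continuous `F`. [folklore] -/
theorem hasDerivAt_orderedIntegral_succ (k : ℕ) {F : (Fin (k + 1) → ℝ) → E} (hF : Continuous F)
    (t : ℝ) :
    HasDerivAt (orderedIntegral (k + 1) F) (orderedIntegral k (fun w => F (Fin.snoc w t)) t) t :=
  ((continuous_orderedIntegral_snoc k hF).integral_hasStrictDerivAt 0 t).hasDerivAt

end Calculus

/-! ### Re-indexing families of integrands along the last coordinate -/

section Family

variable {X E : Type*} {n : ℕ}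

/-- `tupleOn` depends on the index set and the cardinality proof only through a cast. [folklore] -/
theorem tupleOn_congr {S₁ S₂ : Finset (Fin n)} (hS : S₁ = S₂) {k₁ k₂ : ℕ} (h₁ : S₁.card = k₁)
    (h₂ : S₂.card = k₂) (e : k₁ = k₂) (u : Fin n → X) (i : Fin k₁) :
    tupleOn S₁ h₁ u i = tupleOn S₂ h₂ u (Fin.cast e i) := by
  subst hS; subst e; rfl

/-- Changing the arity index of a family `Fam = (Fam_k)_k` along an equality of arities.
[folklore] -/
theorem family_congr (Fam : (k : ℕ) → (Fin k → X) → E) {a b : ℕ} (h : a = b) {x : Fin a → X}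
    {y : Fin b → X} (hxy : ∀ i, x i = y (Fin.cast h i)) : Fam a x = Fam b y := by
  subst h; exact congrArg (Fam a) (funext hxy)

/-- (K1) A subset without the last index: `Fam_{|T|}((w,x)|_T) = Fam_{|T|}(w|_T)`. [folklore] -/
theorem family_map_castSuccEmb_snoc (Fam : (k : ℕ) → (Fin k → X) → E) (T : Finset (Fin n))
    (w : Fin n → X) (x : X) :
    Fam (T.map Fin.castSuccEmb).card (tupleOn (T.map Fin.castSuccEmb) rfl (Fin.snoc w x)) =
      Fam T.card (tupleOn T rfl w) := by
  refine family_congr Fam (card_map _) fun i => ?_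
  rw [tupleOn_congr rfl rfl (card_map _) (card_map _),
    tupleOn_map_castSuccEmb_snoc T (card_map _) rfl]

/-- (K2) Its complement contains the last index:
`Fam_{|Tᶜ|+1}((w,x)|_{(T)ᶜ}) = Fam_{|Tᶜ|+1}(w|_{Tᶜ}, x)`. [folklore] -/
theorem family_compl_map_castSuccEmb_snoc (Fam : (k : ℕ) → (Fin k → X) → E) (T : Finset (Fin n))
    (w : Fin n → X) (x : X) :
    Fam (T.map Fin.castSuccEmb)ᶜ.card (tupleOn (T.map Fin.castSuccEmb)ᶜ rfl (Fin.snoc w x)) =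
      Fam (Tᶜ.card + 1) (Fin.snoc (tupleOn Tᶜ rfl w) x) := by
  have h₃ : (insert (Fin.last n) (Tᶜ.map Fin.castSuccEmb)).card = Tᶜ.card + 1 :=
    card_insert_last_map_castSuccEmb Tᶜ
  have h : (T.map Fin.castSuccEmb)ᶜ.card = Tᶜ.card + 1 := by rw [compl_map_castSuccEmb, h₃]
  refine family_congr Fam h fun i => ?_
  rw [tupleOn_congr (compl_map_castSuccEmb T) rfl h₃ h, tupleOn_insert_last_snoc Tᶜ h₃ rfl]

/-- (K3) A subset with the last index: `Fam_{|T|+1}((w,x)|_{T ∪ {last}}) = Fam_{|T|+1}(w|_T, x)`.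
[folklore] -/
theorem family_insert_last_snoc (Fam : (k : ℕ) → (Fin k → X) → E) (T : Finset (Fin n))
    (w : Fin n → X) (x : X) :
    Fam (insert (Fin.last n) (T.map Fin.castSuccEmb)).card
        (tupleOn (insert (Fin.last n) (T.map Fin.castSuccEmb)) rfl (Fin.snoc w x)) =
      Fam (T.card + 1) (Fin.snoc (tupleOn T rfl w) x) := by
  have h₃ := card_insert_last_map_castSuccEmb T
  refine family_congr Fam h₃ fun i => ?_
  rw [tupleOn_congr rfl rfl h₃ h₃, tupleOn_insert_last_snoc T h₃ rfl]

/-- (K4) Its complement omits the last index: `Fam_{|Tᶜ|}((w,x)|_{(T ∪ {last})ᶜ}) = Fam_{|Tᶜ|}(w|_{Tᶜ})`.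
[folklore] -/
theorem family_compl_insert_last_snoc (Fam : (k : ℕ) → (Fin k → X) → E) (T : Finset (Fin n))
    (w : Fin n → X) (x : X) :
    Fam (insert (Fin.last n) (T.map Fin.castSuccEmb))ᶜ.card
        (tupleOn (insert (Fin.last n) (T.map Fin.castSuccEmb))ᶜ rfl (Fin.snoc w x)) =
      Fam Tᶜ.card (tupleOn Tᶜ rfl w) := by
  have h : (insert (Fin.last n) (T.map Fin.castSuccEmb))ᶜ.card = Tᶜ.card := by
    rw [compl_insert_last_map_castSuccEmb, card_map]
  refine family_congr Fam h fun i => ?_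
  rw [tupleOn_congr (compl_insert_last_map_castSuccEmb T) rfl (card_map _) h,
    tupleOn_map_castSuccEmb_snoc Tᶜ (card_map _) rfl]

/-- Sub-tuples depend continuously on the tuple. [folklore] -/
theorem continuous_tupleOn [TopologicalSpace X] (S : Finset (Fin n)) {k : ℕ} (h : S.card = k) :
    Continuous (tupleOn S h : (Fin n → X) → Fin k → X) :=
  continuous_pi fun _ => continuous_apply _

end Family

/-! ### The shuffle product formula -/

section Shuffle

variable {𝕜 : Type*} [RCLike 𝕜]

/-- The derivative in the upper limit of `t ↦ I_k (F_k) t` for a family: `0` for `k = 0`,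
`I_{k} (F_{k+1}(·, t)) t` for `k + 1`. [folklore] -/
def orderedIntegralDeriv (F : (k : ℕ) → (Fin k → ℝ) → 𝕜) : ℕ → ℝ → 𝕜
  | 0, _ => 0
  | k + 1, t => orderedIntegral k (fun w => F (k + 1) (Fin.snoc w t)) t

/-- `d/dt I_k(F_k) t = orderedIntegralDeriv F k t`. [folklore] -/
theorem hasDerivAt_orderedIntegral_family (F : (k : ℕ) → (Fin k → ℝ) → 𝕜)
    (hF : ∀ k, Continuous (F k)) : ∀ (k : ℕ) (t : ℝ),
      HasDerivAt (orderedIntegral k (F k)) (orderedIntegralDeriv F k t) t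
  | 0, t => by
    have h0 : orderedIntegral 0 (F 0) = fun _ : ℝ => F 0 ![] := rfl
    rw [h0, orderedIntegralDeriv]
    exact hasDerivAt_const t _
  | k + 1, t => hasDerivAt_orderedIntegral_succ k (hF (k + 1)) t

/-- The derivative family is continuous in `t`. [folklore] -/
theorem continuous_orderedIntegralDeriv (F : (k : ℕ) → (Fin k → ℝ) → 𝕜)
    (hF : ∀ k, Continuous (F k)) : ∀ k : ℕ, Continuous (orderedIntegralDeriv F k)
  | 0 => continuous_const
  | k + 1 => continuous_orderedIntegral_snoc k (hF (k + 1))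

/-- Appending a fixed last coordinate to a continuous family gives a continuous family.
[folklore] -/
theorem continuous_family_snoc (F : (k : ℕ) → (Fin k → ℝ) → 𝕜) (hF : ∀ k, Continuous (F k))
    (s : ℝ) (k : ℕ) : Continuous fun v : Fin k → ℝ => F (k + 1) (Fin.snoc v s) :=
  (hF (k + 1)).comp ((continuous_finSnoc k).comp (continuous_id.prodMk continuous_const))

/-- The shuffle integrand is continuous. [folklore] -/
theorem continuous_shuffleIntegrand {n : ℕ} (F G : (k : ℕ) → (Fin k → ℝ) → 𝕜)
    (hF : ∀ k, Continuous (F k)) (hG : ∀ k, Continuous (G k)) :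
    Continuous fun u : Fin n → ℝ => ∑ S : Finset (Fin n),
      F S.card (tupleOn S rfl u) * G Sᶜ.card (tupleOn Sᶜ rfl u) :=
  continuous_finsetSum _ fun S _ =>
    ((hF _).comp (continuous_tupleOn S rfl)).mul ((hG _).comp (continuous_tupleOn Sᶜ rfl))

/-- **The shuffle product formula for ordered integrals** (exponential convolution): for
families `F = (F_j)`, `G = (G_m)` of continuous integrands and every `n`, `t`,
`∫_{0≤u₀≤⋯≤u_{n-1}≤t} Σ_{S ⊆ n} F_{|S|}(u|_S) G_{|Sᶜ|}(u|_{Sᶜ}) du = Σ_{j+m=n} I_j(F_j)(t) I_m(G_m)(t)`: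
distributing ordered variables over two groups in all possible ways (shuffles) reproduces the
product of the two ordered integrals. Brydges 1986 §2; the mechanism by which the Dyson series of
`Tr(e^{-βH}A)` factorises into linked and vacuum parts (BGM 2006 (2.13)–(2.16)). [folklore] -/
theorem orderedIntegral_sum_tupleOn_mul :
    ∀ (n : ℕ) (F G : (k : ℕ) → (Fin k → ℝ) → 𝕜), (∀ k, Continuous (F k)) →
      (∀ k, Continuous (G k)) → ∀ t : ℝ,
      orderedIntegral n (fun u => ∑ S : Finset (Fin n),
          F S.card (tupleOn S rfl u) * G Sᶜ.card (tupleOn Sᶜ rfl u)) t =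
        ∑ p ∈ antidiagonal n, orderedIntegral p.1 (F p.1) t * orderedIntegral p.2 (G p.2) t
  | 0, F, G, hF, hG, t => by
    rw [orderedIntegral_zero, Fintype.sum_subsingleton _ (∅ : Finset (Fin 0)),
      Nat.antidiagonal_zero, sum_singleton, orderedIntegral_zero, orderedIntegral_zero]
    have hc : (∅ : Finset (Fin 0))ᶜ.card = 0 := by simp
    have h1 : F (∅ : Finset (Fin 0)).card (tupleOn (∅ : Finset (Fin 0)) rfl ![]) = F 0 ![] :=
      family_congr F card_empty fun i => i.elim0
    have h2 : G (∅ : Finset (Fin 0))ᶜ.card (tupleOn (∅ : Finset (Fin 0))ᶜ rfl ![]) = G 0 ![] :=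
      family_congr G hc fun i => (Fin.cast hc i).elim0
    rw [h1, h2]
  | n + 1, F, G, hF, hG, t => by
    -- the families with the last variable frozen at `s`
    set Fs : ℝ → (k : ℕ) → (Fin k → ℝ) → 𝕜 := fun s k v => F (k + 1) (Fin.snoc v s) with hFs
    set Gs : ℝ → (k : ℕ) → (Fin k → ℝ) → 𝕜 := fun s k v => G (k + 1) (Fin.snoc v s) with hGs
    have hFs_cont : ∀ s k, Continuous (Fs s k) := fun s k => continuous_family_snoc F hF s k
    have hGs_cont : ∀ s k, Continuous (Gs s k) := fun s k => continuous_family_snoc G hG s k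
    -- the integrand of the outer integral, rewritten by the induction hypothesis
    set ψ : ℝ → 𝕜 := fun s =>
      (∑ p ∈ antidiagonal n, orderedIntegral p.1 (F p.1) s * orderedIntegral p.2 (Gs s p.2) s) +
        ∑ p ∈ antidiagonal n, orderedIntegral p.1 (Fs s p.1) s * orderedIntegral p.2 (G p.2) s
      with hψ
    have hinner : ∀ s : ℝ, orderedIntegral n (fun w => ∑ S : Finset (Fin (n + 1)),
        F S.card (tupleOn S rfl (Fin.snoc w s : Fin (n + 1) → ℝ)) *
          G Sᶜ.card (tupleOn Sᶜ rfl (Fin.snoc w s : Fin (n + 1) → ℝ))) s = ψ s := by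
      intro s
      have hsplit : (fun w : Fin n → ℝ => ∑ S : Finset (Fin (n + 1)),
          F S.card (tupleOn S rfl (Fin.snoc w s : Fin (n + 1) → ℝ)) *
            G Sᶜ.card (tupleOn Sᶜ rfl (Fin.snoc w s : Fin (n + 1) → ℝ))) =
          fun w => (∑ T : Finset (Fin n), F T.card (tupleOn T rfl w) * Gs s Tᶜ.card (tupleOn Tᶜ rfl w)) +
            ∑ T : Finset (Fin n), Fs s T.card (tupleOn T rfl w) * G Tᶜ.card (tupleOn Tᶜ rfl w) := by
        funext w
        rw [sum_finset_fin_succ, sum_add_distrib]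
        congr 1
        · refine sum_congr rfl fun T _ => ?_
          rw [family_map_castSuccEmb_snoc F T w s, family_compl_map_castSuccEmb_snoc G T w s]
        · refine sum_congr rfl fun T _ => ?_
          rw [family_insert_last_snoc F T w s, family_compl_insert_last_snoc G T w s]
      rw [hsplit, orderedIntegral_add n (continuous_shuffleIntegrand F (Gs s) hF (hGs_cont s))
        (continuous_shuffleIntegrand (Fs s) G (hFs_cont s) hG),
        orderedIntegral_sum_tupleOn_mul n F (Gs s) hF (hGs_cont s) s,
        orderedIntegral_sum_tupleOn_mul n (Fs s) G (hFs_cont s) hG s]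
    -- the right-hand side as a function of `t`, its value at `0` and its derivative
    set Ψ : ℝ → 𝕜 := fun t =>
      ∑ p ∈ antidiagonal (n + 1), orderedIntegral p.1 (F p.1) t * orderedIntegral p.2 (G p.2) t
      with hΨ
    have hΨ0 : Ψ 0 = 0 := by
      refine sum_eq_zero fun p hp => ?_
      rcases p with ⟨i, j⟩
      rw [HasAntidiagonal.mem_antidiagonal] at hp
      rcases i with _ | i
      · obtain rfl : j = n + 1 := by simpa using hp
        rw [orderedIntegral_succ_zero, mul_zero]
      · rw [orderedIntegral_succ_zero, zero_mul]
    -- the derivative of `Ψ` is `ψ` (product rule, then re-indexing the antidiagonal)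
    have hψ_eq : ∀ s : ℝ, (∑ p ∈ antidiagonal (n + 1),
        (orderedIntegralDeriv F p.1 s * orderedIntegral p.2 (G p.2) s +
          orderedIntegral p.1 (F p.1) s * orderedIntegralDeriv G p.2 s)) = ψ s := by
      intro s
      rw [sum_add_distrib, Nat.sum_antidiagonal_succ (f := fun p =>
          orderedIntegralDeriv F p.1 s * orderedIntegral p.2 (G p.2) s),
        Nat.sum_antidiagonal_succ' (f := fun p =>
          orderedIntegral p.1 (F p.1) s * orderedIntegralDeriv G p.2 s)]
      simp only [orderedIntegralDeriv, zero_mul, mul_zero, zero_add, hψ]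
      exact add_comm _ _
    have hΨ_fn : Ψ = ∑ p ∈ antidiagonal (n + 1),
        fun t => orderedIntegral p.1 (F p.1) t * orderedIntegral p.2 (G p.2) t := by
      funext t; simp only [hΨ, Finset.sum_apply]
    have hψ_cont : Continuous ψ := by
      simp only [hψ]
      refine Continuous.add (continuous_finsetSum _ fun p _ => ?_)
        (continuous_finsetSum _ fun p _ => ?_)
      · exact (continuous_orderedIntegral_right _ (hF _)).mul
          (continuous_orderedIntegralDeriv G hG (p.2 + 1))
      · exact (continuous_orderedIntegralDeriv F hF (p.1 + 1)).mul
          (continuous_orderedIntegral_right _ (hG _))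
    -- assemble: `I_{n+1}(t) = ∫₀ᵗ ψ = Ψ t - Ψ 0 = Ψ t`
    rw [orderedIntegral_succ]
    rw [show (∫ s in (0:ℝ)..t, orderedIntegral n (fun w => ∑ S : Finset (Fin (n + 1)),
        F S.card (tupleOn S rfl (Fin.snoc w s : Fin (n + 1) → ℝ)) *
          G Sᶜ.card (tupleOn Sᶜ rfl (Fin.snoc w s : Fin (n + 1) → ℝ))) s) = ∫ s in (0:ℝ)..t, ψ s
      from integral_congr fun s _ => hinner s]
    rw [integral_eq_sub_of_hasDerivAt (f := Ψ) (fun s _ => ?_) (hψ_cont.intervalIntegrable 0 t), hΨ0,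
      sub_zero]
    rw [hΨ_fn]
    exact (HasDerivAt.sum (u := antidiagonal (n + 1))
      (A := fun p t => orderedIntegral p.1 (F p.1) t * orderedIntegral p.2 (G p.2) t)
      (A' := fun p => orderedIntegralDeriv F p.1 s * orderedIntegral p.2 (G p.2) s +
        orderedIntegral p.1 (F p.1) s * orderedIntegralDeriv G p.2 s) (x := s)
      (fun p _ => (hasDerivAt_orderedIntegral_family F hF p.1 s).mul
        (hasDerivAt_orderedIntegral_family G hG p.2 s))).congr_deriv (hψ_eq s)

end Shuffle

end Literature.MathematicalPhysics.QuantumLattice
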